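import Summits.ResolutionOfSingularities.ResolutionOfSingularities.Theorems.AbhyankarShadowsShadowsUniformizeLurelDenseAbhyankar
import HarnessLib

/-!
# Transport of the dense-Abhyankar property between abstract residue fields (`stub_isDenseAbhyankar_residue_transport`)

Stub of the birth line of the crux `ShadowsUniformize` (stmt-ResolutionOfSingularities-16756, route
`AbhyankarShadows`), composite-uniformizable branch (lead c3). In the Novacoski–Spivakovsky
decomposition `ν = ν₁ ∘ ν₂` of a valuation ring `O ≤ O₁` of a function field `K/k`, the residue
valuation ring `W` lives in the residue field `L := κ(O₁)`; the composition lemma hands over an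
ABSTRACT field `κ'` with a `k`-algebra structure and a `k`-compatible SURJECTIVE ring homomorphism
`ι' : κ' → L`, while the hypothesis "the residue valuation lies in the dense-Abhyankar locus"
(some finitely generated intermediate field `κ₀` on which the place `W.comap ι` is an Abhyankar
place over the constants, with `κ` dense over `κ₀`, `IsDenseIn`) is given for ANOTHER such pair
`(κ, ι)`. This file moves it from `(κ, ι)` to `(κ', ι')`: pure transport along the `k`-algebra
isomorphism `e := ι'⁻¹ ∘ ι : κ ≃ₐ[k] κ'`.

Proof: `ι`, `ι'` are bijective, so `e` is a ring isomorphism with `ι' ∘ e = ι`; `k`-compatibility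
(`hcompat`) and injectivity of `ι'` make it a `k`-algebra isomorphism. Put `κ₀' := κ₀.map e`. Then
`κ₀'` is finitely generated (`IntermediateField.adjoin_map`); `e⁻¹(W.comap ι') = W.comap ι`
(`ValuationSubring.comap_comap`), so the Abhyankar property is transported by the tree's
`isAbhyankarPlace_map` (with `e(k) = k`, `RingHom.map_fieldRange`, and
`e(κ₀) = (κ₀.map e).toSubfield`, `IntermediateField.toSubfield_map`), and density by the tree's
`isDenseIn_map` (with `e(κ) = κ'` by surjectivity). No named facts are used.

## Sources

* [KK09] H. Knaf, F.-V. Kuhlmann, *Every place admits local uniformization in a finite extension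
  of the function field*, Adv. Math. 221 (2009) 428–453: Thm. 1.5 (places in the completion of an
  Abhyankar subfunction field). [KnafKuhlmann2009]
* [NS14] J. Novacoski, M. Spivakovsky, *Reduction of local uniformization to the rank one case*,
  2014: §2.1, Remark 2.4 (the decomposition `ν = ν₁ ∘ ν₂`). [NovacoskiSpivakovsky2014]
-/

noncomputable section

-- single-problem summit: the doubled namespace component is forced
set_option linter.dupNamespace false

open Literature.AlgebraicGeometry.Resolution IsLocalRing

namespace Summit.ResolutionOfSingularities.ResolutionOfSingularities.Theorems

/-- **Two `k`-compatible residue-field parametrisations differ by a `k`-algebra isomorphism.**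
If `ι : κ → L` and `ι' : κ' → L` are surjective ring homomorphisms of fields agreeing on `k`,
there is a `k`-algebra isomorphism `e : κ ≃ₐ[k] κ'` with `ι' ∘ e = ι`. [folklore] -/
theorem exists_algEquiv_comp_eq_of_surjective (k κ κ' L : Type) [Field k] [Field κ] [Field κ']
    [Field L] [Algebra k κ] [Algebra k κ'] (ι : κ →+* L) (ι' : κ' →+* L)
    (hι : Function.Surjective ι) (hι' : Function.Surjective ι')
    (hcompat : ∀ c : k, ι (algebraMap k κ c) = ι' (algebraMap k κ' c)) :
    ∃ e : κ ≃ₐ[k] κ', ∀ x : κ, ι' (e x) = ι x := by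
  let e₁ : κ ≃+* L := RingEquiv.ofBijective ι ⟨ι.injective, hι⟩
  let e₂ : κ' ≃+* L := RingEquiv.ofBijective ι' ⟨ι'.injective, hι'⟩
  let e₀ : κ ≃+* κ' := e₁.trans e₂.symm
  have he₀ : ∀ x : κ, ι' (e₀ x) = ι x := fun x => by
    have h1 : e₀ x = e₂.symm (e₁ x) := rfl
    have h2 : ∀ z : κ', ι' z = e₂ z := fun z => rfl
    have h3 : e₁ x = ι x := rfl
    rw [h1, h2, RingEquiv.apply_symm_apply, h3]
  have hcomm : ∀ c : k, e₀ (algebraMap k κ c) = algebraMap k κ' c := fun c =>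
    ι'.injective (by rw [he₀, hcompat])
  exact ⟨AlgEquiv.ofRingEquiv hcomm, he₀⟩

/-- **Transport of the dense-Abhyankar property between abstract residue fields.** For
surjective ring homomorphisms of fields `ι : κ → L`, `ι' : κ' → L` agreeing on `k` and a
valuation ring `W` of `L`: if for some finitely generated `κ₀ ≤ κ` the place `W.comap ι` is an
Abhyankar place of `κ₀ | k` with `κ` dense over `κ₀`, then the same holds on `κ'` for
`κ₀' := κ₀.map e`, `e := ι'⁻¹ ∘ ι : κ ≃ₐ[k] κ'` (finite generation by `adjoin_map`, the
Abhyankar property by `isAbhyankarPlace_map`, density by `isDenseIn_map` and `e(κ) = κ'`).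
[folklore] -/
theorem stub_isDenseAbhyankar_residue_transport (k κ κ' L : Type) [Field k] [Field κ] [Field κ']
    [Field L] [Algebra k κ] [Algebra k κ'] (W : ValuationSubring L) (ι : κ →+* L) (ι' : κ' →+* L)
    (hι : Function.Surjective ι) (hι' : Function.Surjective ι')
    (hcompat : ∀ c : k, ι (algebraMap k κ c) = ι' (algebraMap k κ' c))
    (hD : ∃ κ₀ : IntermediateField k κ, κ₀.FG ∧
      IsAbhyankarPlace (W.comap ι) (algebraMap k κ).fieldRange κ₀.toSubfield ∧
      IsDenseIn (W.comap ι) κ₀.toSubfield ⊤) :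
    ∃ κ₀' : IntermediateField k κ', κ₀'.FG ∧
      IsAbhyankarPlace (W.comap ι') (algebraMap k κ').fieldRange κ₀'.toSubfield ∧
      IsDenseIn (W.comap ι') κ₀'.toSubfield ⊤ := by
  classical
  obtain ⟨κ₀, hfg, hA, hd⟩ := hD
  obtain ⟨e, he⟩ := exists_algEquiv_comp_eq_of_surjective k κ κ' L ι ι' hι hι' hcompat
  -- the underlying ring homomorphism `f` of `e` and its compatibilities
  set f : κ →+* κ' := (e.toAlgHom : κ →+* κ') with hf
  have hfe : ∀ x : κ, f x = e x := fun x => rfl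
  have hιf : ι'.comp f = ι := RingHom.ext fun x => by rw [RingHom.comp_apply, hfe, he]
  have hV : (W.comap ι').comap f = W.comap ι := by
    rw [ValuationSubring.comap_comap, hιf]
  have hK : (algebraMap k κ).fieldRange.map f = (algebraMap k κ').fieldRange := by
    rw [RingHom.map_fieldRange, hf, AlgHom.comp_algebraMap]
  have hF : κ₀.toSubfield.map f = (κ₀.map e.toAlgHom).toSubfield := by
    rw [IntermediateField.toSubfield_map]
  have hT : (⊤ : Subfield κ).map f = ⊤ := by
    rw [← RingHom.fieldRange_eq_map, RingHom.fieldRange_eq_top_iff]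
    intro y
    exact ⟨e.symm y, by rw [hfe, AlgEquiv.apply_symm_apply]⟩
  refine ⟨κ₀.map e.toAlgHom, ?_, ?_, ?_⟩
  · -- finite generation
    obtain ⟨t, rfl⟩ := hfg
    refine ⟨t.image e.toAlgHom, ?_⟩
    rw [Finset.coe_image, ← IntermediateField.adjoin_map]
  · -- the Abhyankar property
    have h := isAbhyankarPlace_map f hV hA
    rwa [hK, hF] at h
  · -- density
    have h := isDenseIn_map f hV hd
    rwa [hF, hT] at h

end Summit.ResolutionOfSingularities.ResolutionOfSingularities.Theorems

end
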